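import Summits.BirchSwinnertonDyer.Rank1Residual.X1.LocalPackageRatStrict
import Summits.BirchSwinnertonDyer.Rank1Residual.X1.LocalPackageRatOne
import HarnessLib

/-!
# THE `e = 1` LOCAL PACKAGE at the prime `wp` of `ℚ_n` above an ANOMALOUS `p`, with FILE 24b's
# strictness clause — no rational `p`-torsion (route R1′, V99)
# (cell `b2b-bsdres`, unit `b2b-bsdres-eisenstein-p1`, gen 21; X1R0-GAPMAP §29–§30)

HONEST FRAMING (run/shared/lean/b2b/bsd-rank1-residual/, verbatim in every file): the goal of the
cell is to DELETE the COMBINATION-SHAPED residual classes of the Birch–Swinnerton-Dyer formula for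
ALL analytic-rank `≤ 1` elliptic curves over `ℚ` — "full BSD formula for every rank `≤ 1` curve in
class `C`" assembled STRICTLY from published theorems — so that the rank-`≤ 1` remainder becomes
exactly the CONSTRUCTION-SHAPED classes, which are TYPED (missing-input `Prop`s), NOT attempted.
This is not "finishing BSD". Sub-cell `b2b-bsdres-eisenstein-p1`: research route; NO CLAIM BEYOND
STATED CLASSES; nothing here changes a label; nothing is booked. THEOREMS ONLY — no definition, no
named fact introduced; Tate's local Euler–Poincaré characteristic (`hEP`) is a HYPOTHESIS exactly as
in gen 20's `X1/LocalPackageRatStrict`.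

## What and why

Gen 20's `LocalPackageRatStrict.exists_strict_addSubgroup` = the local package at `wp` with index
`p²` and FILE 24b's `hstrict` clause, for curves with a RATIONAL point of order `p`. THIS FILE is the
same transfer (§§1–3 of that file, reused by name) on top of gen 21's `e = 1` raw package
`LocalPackageRatOne.exists_addSubgroup_redStrict_one` (anomaly `hanom : p ∣ #Ẽ(𝔽_p)` as hypothesis,
no torsion): `exists_strict_addSubgroup_of_red_one`, **`exists_strict_addSubgroup_one`** — `∃ 𝓛 ⊇ 𝓚_wp`,
`p ^ 1 · #𝓚_wp ≤ #𝓛`, FILE 24b's `hstrict` verbatim. Consumer: `X1/GeneratorCountLayerAtPLocalOne`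
(`p^{#T₀ + 1} ≤ p^{λ + pⁿμ} · (#E[p^∞]^{Γ_ℚ})²` at every anomalous good ordinary odd `p`).

References: [GreenbergLNM1716] §2 Prop. 2.4, §3 Lemma 3.4 (p. 89), §5 pp. 114–118;
[MilneADT2006] I Thm. 2.8; [SilvermanAEC2009] VII.§2–3; [NeukirchANT1999] II (4.8), (9.3).
-/

noncomputable section

open scoped Classical NNReal

open Function Field NumberField IsDedekindDomain WeierstrassCurve
  Literature.NumberTheory.EllipticCurves Literature.NumberTheory.GaloisRepresentations
  IsDedekindDomain.HeightOneSpectrum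
  Summit.BirchSwinnertonDyer.Rank1Residual.Additive.LocalTransport
  Summit.BirchSwinnertonDyer.Rank1Residual.Additive
  Summit.BirchSwinnertonDyer.Rank1Residual.Additive.ZpTower
  Summit.BirchSwinnertonDyer.Rank1Residual.X2.GreenbergVatsalReductionDatum
open Literature.NumberTheory.EllipticCurves.GreenbergSelmer (inertiaIn inertiaInToH inertia
  mem_inertiaIn_iff)

set_option autoImplicit false

-- NB (as in `X1/LocalPackageRat`): no local `[NumberField (κ.layer n)]` hypotheses; Galois elements
-- are kept as opaque locals and equations between them are used through `simp only` (reducible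
-- matching), since `isDefEq` unfolding `resGalOfEmb`/`transportAut`/`pointsMap` and the two
-- `Algebra ℚ ℚ_n` instance paths is what exhausts heartbeats here.

namespace Summit.BirchSwinnertonDyer.Rank1Residual.X1.LocalPackageRatStrictOne

variable (W : WeierstrassCurve ℚ) [W.IsElliptic] [W.IsGloballyMinimal] {p : ℕ} [hp : Fact p.Prime]
  (κ : ZpExtension ℚ p) (n : ℕ) (κn : ZpExtension (κ.layer n) p)
  (hκn : ∀ σ : Field.absoluteGaloisGroup (κ.layer n),
    (κn σ).toAdd * (p : ℤ_[p]) ^ n = (κ (resGal (K := ℚ) (κ.layer n) σ)).toAdd)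
  {v : HeightOneSpectrum (𝓞 ℚ)} (hpv : ((p : ℕ) : 𝓞 ℚ) ∈ v.asIdeal)
  (hΔ : ¬ (p : ℤ) ∣ minimalDiscriminantInt W)
  (wp : HeightOneSpectrum (𝓞 (κ.layer n))) [wp.asIdeal.LiesOver v.asIdeal]
  -- the factorisation data (n1011 shape)
  (ι₂ : AlgebraicClosure (v.adicCompletion ℚ) ≃+* AlgebraicClosure (wp.adicCompletion (κ.layer n)))
  (hι₂ : ∀ x : v.adicCompletion ℚ,
    ι₂ (algebraMap (v.adicCompletion ℚ) (AlgebraicClosure (v.adicCompletion ℚ)) x) =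
      algebraMap (wp.adicCompletion (κ.layer n)) (AlgebraicClosure (wp.adicCompletion (κ.layer n)))
        (adicCompletionMap (K := ℚ) (κ.layer n) v wp x))
  (ι' : AlgebraicClosure (κ.layer n) →ₐ[κ.layer n] AlgebraicClosure (wp.adicCompletion (κ.layer n)))
  (hcompat : ∀ z : AlgebraicClosure ℚ,
    ι' (closureEmb (K := ℚ) (κ.layer n) z) = ι₂ (closureEmb (K := ℚ) (v.adicCompletion ℚ) z))
  (hfix : ∀ h : absoluteGaloisGroup (v.adicCompletion ℚ),
    resGalOfEmb (closureEmb (K := ℚ) (v.adicCompletion ℚ)) h ∈ κ.layerSubgroup n →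
    ∀ y : wp.adicCompletion (κ.layer n),
      (show AlgebraicClosure (v.adicCompletion ℚ) ≃ₐ[v.adicCompletion ℚ]
          AlgebraicClosure (v.adicCompletion ℚ) from h)
        (ι₂.symm (algebraMap _ (AlgebraicClosure (wp.adicCompletion (κ.layer n))) y)) =
        ι₂.symm (algebraMap _ (AlgebraicClosure (wp.adicCompletion (κ.layer n))) y))
  (τ : Field.absoluteGaloisGroup (κ.layer n))
  (hτ : ι' = (closureEmb (K := κ.layer n) (wp.adicCompletion (κ.layer n))).comp
    ((show AlgebraicClosure (κ.layer n) ≃ₐ[κ.layer n] AlgebraicClosure (κ.layer n) from τ) :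
      AlgebraicClosure (κ.layer n) →ₐ[κ.layer n] AlgebraicClosure (κ.layer n)))

/-! ## The `e = 1` local package with the strictness clause of FILE 24b -/

set_option maxHeartbeats 400000 in -- the statement alone (FILE 24b's clause: `kerOfKer`, `β⁻¹`,
-- `inclusion`, `localRed`) plus the `ℚ`-level/`K`-general instance unifications sit at the cliff.
include hκn hpv hΔ hι₂ hcompat hfix hτ in
/-- **THE `e = 1` LOCAL PACKAGE at the prime `wp` of `ℚ_n` above an ANOMALOUS `p`, for a given
reduction datum `(w, M, red)` at `wp`.** `E/ℚ` globally minimal elliptic, `p` odd, `p ∤ Δ_E`, `p ∤ a_p`,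
`p ∣ #Ẽ(𝔽_p)` (no rational `p`-torsion assumed), `κ` cyclotomic, Tate's local Euler–Poincaré
characteristic at `(ℚ_n)_wp` (`hEP`); factorisation data `(ι₂, ι', τ, hfix)` for `wp ∣ v ∋ p`. Then
there is `𝓛 ≤ H¹((ℚ_n)_wp, E[p])` with `𝓚_wp ≤ 𝓛`, `p ^ 1 · #𝓚_wp ≤ #𝓛`, and: every cocycle `φ`
over `ℚ_n` whose class localises into `𝓛` has `localRed(pointsMap(β⁻¹ φ(kerOfKer x))) = Õ` for every
`x ∈ I_v ∩ Gal(ℚ̄/ℚ_∞)` (FILE 24b's `hstrict`). Gen 20's proof with `LocalPackageRatOne`.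
[cite: GreenbergLNM1716, §2 Prop. 2.4, §3 Lemma 3.4 (p. 89), §5 pp. 114–118]
[cite: MilneADT2006, I Thm. 2.8] [cite: SilvermanAEC2009, VII.§2–3] -/
theorem exists_strict_addSubgroup_of_red_one
    {w : Valuation (AlgebraicClosure (wp.adicCompletion (κ.layer n))) ℝ≥0}
    (hw : ∀ x, (w x : ℝ) = spectralNorm (wp.adicCompletion (κ.layer n))
      (AlgebraicClosure (wp.adicCompletion (κ.layer n))) x)
    {M : WeierstrassCurve ↥w.valuationSubring}
    (hMK : M.baseChange (AlgebraicClosure (wp.adicCompletion (κ.layer n))) =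
      (W.baseChange (κ.layer n)).baseChange (AlgebraicClosure (wp.adicCompletion (κ.layer n))))
    {red : localPoints (W.baseChange (κ.layer n)) (wp.adicCompletion (κ.layer n)) →+
      (M.map (IsLocalRing.residue ↥w.valuationSubring)).toAffine.Point}
    (hred : ∀ P, red P = M.reducePoint (Affine.Point.congrEquiv hMK.symm P)) (hΔ' : IsUnit M.Δ)
    (hκ : κ.IsCyclotomic) (hodd : p ≠ 2)
    (hord : ¬ (p : ℤ) ∣ W.frobeniusTrace p) (hanom : p ∣ W.reductionPointCount p)
    (hEP : localEulerPoincareCharacteristic (wp.adicCompletion (κ.layer n))) :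
    ∃ 𝓛 : AddSubgroup (galoisCohomology (GaloisRep.restrictField (wp.adicCompletion (κ.layer n))
        ((W.baseChange (κ.layer n)).torsionGaloisModule (p : ℤ))) 1),
      (W.baseChange (κ.layer n)).kummerLocalConditionAt (p : ℤ) (wp.adicCompletion (κ.layer n)) ≤ 𝓛 ∧
      p ^ 1 * Nat.card ((W.baseChange (κ.layer n)).kummerLocalConditionAt (p : ℤ)
        (wp.adicCompletion (κ.layer n))) ≤ Nat.card 𝓛 ∧
      ∀ φ : contOneCocycles (discreteTopRep (Field.absoluteGaloisGroup (κ.layer n))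
          (geomTorsion (W.baseChange (κ.layer n)) (p : ℤ))),
        galoisCohomology.localization ((W.baseChange (κ.layer n)).torsionGaloisModule (p : ℤ))
          (Sum.inr wp) 1 (oneCocycleClass (discreteTopRep (Field.absoluteGaloisGroup (κ.layer n))
            (geomTorsion (W.baseChange (κ.layer n)) (p : ℤ))) φ) ∈ 𝓛 →
        ∀ x : inertiaIn κ.kerSubgroup v,
          localRed W p hpv hΔ (pointsMap W (v.adicCompletion ℚ)
            (((primaryBaseChangeEquiv (κ.layer n) W p).symm
              (AddSubgroup.inclusion (geomTorsion_le_geomPrimaryTorsion (W.baseChange (κ.layer n)) p)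
                (φ.1 ((kerOfKer κ n κn hκn (inertiaInToH κ.kerSubgroup v x) : κn.kerSubgroup) :
                  Field.absoluteGaloisGroup (κ.layer n)))) : W.geomPrimaryTorsion p) :
              W.geomPoints)) = 0 := by
  have hpack := LocalPackageRatOne.exists_addSubgroup_redStrict_one W κ n κn hκn hpv hΔ wp ι₂ hι₂ ι'
    hcompat hfix τ hτ hw hMK hred hΔ' hκ hodd hord hanom hEP
  obtain ⟨𝓛, h𝓛, hidx, hstr⟩ := hpack
  refine ⟨𝓛, h𝓛, hidx, fun φ hφ x ↦ ?_⟩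
  -- `x = resGal(res_{ι'} g)`, `g ∈ I_{(ℚ_n)_wp}`; `σ := res_{ι'} g = kerOfKer x ∈ ker κ_n`; `res g ∈ ker κ_n`
  have hg := LocalPackageRatStrict.exists_absInertia_resGal_eq κ n wp ι₂ hι₂ ι' hcompat hfix x
  obtain ⟨g, hgI, hgx⟩ := hg
  have hk := LocalPackageRatStrict.mem_kerSubgroup_and_eq_kerOfKer κ n κn hκn (resGalOfEmb ι' g) x hgx
  obtain ⟨hmemK, hσ⟩ := hk
  have hgH := LocalPackageRatStrict.absGaloisRestrict_mem_kerSubgroup κ n κn wp ι' τ hτ g hmemK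
  -- the cocycle of the local class computed through `ι'`, evaluated at `g`
  have hψcex := LocalPackageParts.exists_cocycle_conj_eq_res (W.baseChange (κ.layer n))
    (p : ℤ) _ ι' τ hτ φ
  obtain ⟨ψc, hψc, hψcval⟩ := hψcex
  have key := hstr _ hφ ψc hψc g hgI hgH
  rw [hψcval] at key
  rw [hσ]
  exact LocalPackageRatStrict.localRed_eq_zero_of_red_eq_zero W κ n hpv hΔ wp ι₂ hι₂ ι' hcompat τ hτ
    hw hMK hred hΔ' _ key

set_option maxHeartbeats 400000 in -- as `exists_strict_addSubgroup_of_red_one` (same statement)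
include hκn hpv hΔ hι₂ hcompat hfix hτ in
/-- **THE `e = 1` LOCAL PACKAGE at the prime `wp` of `ℚ_n` above an ANOMALOUS `p`.** `E/ℚ` globally
minimal elliptic, `p` odd, `p ∤ Δ_E`, `p ∤ a_p`, `p ∣ #Ẽ(𝔽_p)` (no rational `p`-torsion assumed), `κ`
cyclotomic, and Tate's local Euler–Poincaré characteristic at `(ℚ_n)_wp` (`hEP`); factorisation data
`(ι₂, ι', τ, hfix)` for `wp ∣ v ∋ p`. Then there is `𝓛 ≤ H¹((ℚ_n)_wp, E[p])` with `𝓚_wp ≤ 𝓛`,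
`p ^ 1 · #𝓚_wp ≤ #𝓛`, and:
every cocycle `φ` over `ℚ_n` whose class localises into `𝓛` has `localRed(pointsMap(β⁻¹ φ(x))) = Õ`
for every `x ∈ I_v ∩ Gal(ℚ̄/ℚ_∞)` (FILE 24b's `hstrict`, for every representative); the reduction
datum is the minimal model over the valuation ring of the spectral valuation (§1).
[cite: GreenbergLNM1716, §2 Prop. 2.4, §3 Lemma 3.4 (p. 89), §5 pp. 114–118]
[cite: MilneADT2006, I Thm. 2.8] [cite: SilvermanAEC2009, VII.§2–3] -/
theorem exists_strict_addSubgroup_one (hκ : κ.IsCyclotomic) (hodd : p ≠ 2)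
    (hord : ¬ (p : ℤ) ∣ W.frobeniusTrace p) (hanom : p ∣ W.reductionPointCount p)
    (hEP : localEulerPoincareCharacteristic (wp.adicCompletion (κ.layer n))) :
    ∃ 𝓛 : AddSubgroup (galoisCohomology (GaloisRep.restrictField (wp.adicCompletion (κ.layer n))
        ((W.baseChange (κ.layer n)).torsionGaloisModule (p : ℤ))) 1),
      (W.baseChange (κ.layer n)).kummerLocalConditionAt (p : ℤ) (wp.adicCompletion (κ.layer n)) ≤ 𝓛 ∧
      p ^ 1 * Nat.card ((W.baseChange (κ.layer n)).kummerLocalConditionAt (p : ℤ)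
        (wp.adicCompletion (κ.layer n))) ≤ Nat.card 𝓛 ∧
      ∀ φ : contOneCocycles (discreteTopRep (Field.absoluteGaloisGroup (κ.layer n))
          (geomTorsion (W.baseChange (κ.layer n)) (p : ℤ))),
        galoisCohomology.localization ((W.baseChange (κ.layer n)).torsionGaloisModule (p : ℤ))
          (Sum.inr wp) 1 (oneCocycleClass (discreteTopRep (Field.absoluteGaloisGroup (κ.layer n))
            (geomTorsion (W.baseChange (κ.layer n)) (p : ℤ))) φ) ∈ 𝓛 →
        ∀ x : inertiaIn κ.kerSubgroup v,
          localRed W p hpv hΔ (pointsMap W (v.adicCompletion ℚ)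
            (((primaryBaseChangeEquiv (κ.layer n) W p).symm
              (AddSubgroup.inclusion (geomTorsion_le_geomPrimaryTorsion (W.baseChange (κ.layer n)) p)
                (φ.1 ((kerOfKer κ n κn hκn (inertiaInToH κ.kerSubgroup v x) : κn.kerSubgroup) :
                  Field.absoluteGaloisGroup (κ.layer n)))) : W.geomPrimaryTorsion p) :
              W.geomPoints)) = 0 := by
  have hwex := wp.exists_spectralValuation
  obtain ⟨w, hw⟩ := hwex
  have hMK := LocalPackageRat.localIntModel_baseChange_layer W κ n wp w.valuationSubring
  have hΔ' := LocalPackageRat.isUnit_Δ_localIntModel_layer W κ n hpv hΔ wp hw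
  have hex := @LocalReductionStrict.exists_red (κ.layer n) _ _ (W.baseChange (κ.layer n)) wp w
    ((integralModelInt W).map (algebraMap ℤ w.valuationSubring)) hMK hΔ'
  obtain ⟨red, hred⟩ := hex
  exact exists_strict_addSubgroup_of_red_one W κ n κn hκn hpv hΔ wp ι₂ hι₂ ι' hcompat hfix τ hτ hw
    hMK hred hΔ' hκ hodd hord hanom hEP

end Summit.BirchSwinnertonDyer.Rank1Residual.X1.LocalPackageRatStrictOne

end
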